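import Mathlib
import HarnessLib
import HarnessLib.Audit
import Summits.NavierStokesRegularity.Statement
import Literature.Analysis.FluidPDE.LocalTypeI
import Literature.Analysis.FluidPDE.KatoMaximalTime
import Literature.Analysis.FluidPDE.MildSolutions
import Literature.Analysis.FluidPDE.ClassicalSolution
import Literature.Analysis.FluidPDE.NormalisedPressure
import Literature.Analysis.FluidPDE.SuitableWeak
import Literature.Analysis.FluidPDE.SelfSimilar
import Literature.Analysis.FluidPDE.WeakSolution
import Literature.Analysis.FluidPDE.NSWave0
import Summits.NavierStokesRegularity.NavierStokesRegularity.Theorems.TypeICertificateLadderNoBlowupToClay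
import HarnessLib.Audit.Status.Attr

/-!
Route: HardyPointSink

# Route HardyPointSink — the delta inside Δ(1/r) — Hardy-bounded blow-up is Type I and tail-free, so
a singularity must drink divergent head

X = HardyEnergyBound ∧ NoHardyTypeIAncient ("it suffices to show X"; realises idea card
hardy-point-sink-head-influx).
Object: the critical HARDY ENERGY of a solution at a point, H(x₀,t) = ∫ |u(x,t)|² |x−x₀|⁻¹ dx
(scale-invariant; the Newtonian weight is
the one weight with Δ(1/r) = −4πδ, so testing the exact local energy identity against it turns
viscosity into a POINT SINK:
d/dt ∫|u|²/r = −2∫Π u_r r⁻² − 2ν∫|∇u|²/r − 4πν|u(x₀,t)|², Π = |u|²/2 + p — the only source is the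
advective influx of Bernoulli head).
HardyEnergyBound (C2): for every ν > 0, every Clay datum u₀ and every Kato solution u on [0,T) from
u₀, the LOCAL Hardy energy
∫_{B(x*,r₀)} |u(t,x)|²/|x−x₀| dx stays bounded for all centres x₀ near any point x* and all times
T−r₀² < t < T (content only at
T = T_max: "a singularity must drink divergent head"). NoHardyTypeIAncient (C3): there is no
nontrivial mild bounded ancient solution
(ν = 1, measurable slices, suitable on (−∞,0)×ℝ³) with Albritton–Barker 𝐈 < ∞ AND sup_{x₀, s}
∫|u(s,y)|²/|y−x₀| dy < ∞ — the
Liouville conjecture (L′) of route MarginalTypeI (stmt-1749) restricted to HARDY-BOUNDED (=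
tail-free) Type-I profiles.
Lean: `(∀ ν : ℝ, 0 < ν → ∀ u₀ : EuclideanSpace ℝ (Fin 3) → EuclideanSpace ℝ (Fin 3), ContDiff ℝ (⊤ :
ℕ∞) u₀ → Literature.Analysis.FluidPDE.NSWave0.IsDivFree u₀ →
Literature.Analysis.FluidPDE.HasRapidSpatialDecay u₀ → ∀ (T : ℝ) (u : ℝ → EuclideanSpace ℝ (Fin 3) →
EuclideanSpace ℝ (Fin 3)), 0 < T → Literature.Analysis.FluidPDE.IsKatoSolutionOn T ν u₀ u → ∀ xs :
EuclideanSpace ℝ (Fin 3), ∃ r₀ : ℝ, 0 < r₀ ∧ ∃ K : NNReal, ∀ x₀ ∈ Metric.ball xs r₀, ∀ t ∈ Set.Ico 0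
T, T - r₀ ^ 2 < t → ∫⁻ x in Metric.ball xs r₀, ‖u t x‖ₑ ^ 2 / ‖x - x₀‖ₑ ≤ K) ∧ (¬ ∃ (u : ℝ →
EuclideanSpace ℝ (Fin 3) → EuclideanSpace ℝ (Fin 3)) (p : ℝ → EuclideanSpace ℝ (Fin 3) → ℝ) (G : ℝ →
EuclideanSpace ℝ (Fin 3) → EuclideanSpace ℝ (Fin 3) →L[ℝ] EuclideanSpace ℝ (Fin 3)), (∀ t < 0,
MeasureTheory.AEStronglyMeasurable (u t) MeasureTheory.volume) ∧
Literature.Analysis.FluidPDE.IsBoundedAncientMildSolution 1 u ∧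
Literature.Analysis.FluidPDE.IsSuitableWeakSolutionOn (Literature.Analysis.FluidPDE.slab
(EuclideanSpace ℝ (Fin 3)) (Set.Iio 0) isOpen_Iio) 1 0 u p ∧
Literature.Analysis.FluidPDE.HasWeakSpatialGradientOn (Literature.Analysis.FluidPDE.slab
(EuclideanSpace ℝ (Fin 3)) (Set.Iio 0) isOpen_Iio) u G ∧ ¬ (Function.uncurry u
=ᵐ[MeasureTheory.volume.restrict (Set.Iio (0 : ℝ) ×ˢ (Set.univ : Set (EuclideanSpace ℝ (Fin 3))))]
0) ∧ Literature.Analysis.FluidPDE.typeIBound (Set.Iio (0 : ℝ) ×ˢ (Set.univ : Set (EuclideanSpace ℝ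
(Fin 3)))) u p G < ⊤ ∧ ∃ K : NNReal, ∀ x₀ : EuclideanSpace ℝ (Fin 3), ∀ᵐ t
∂(MeasureTheory.volume.restrict (Set.Iio (0 : ℝ))), ∫⁻ x, ‖u t x‖ₑ ^ 2 / ‖x - x₀‖ₑ ≤ K)`

## Assembly
Pure logic plus the PROVED tree fact
Literature.Analysis.FluidPDE.clay_solution_of_hasGlobalKatoSolution_holds (NSKatoToClayHolds.lean),
exactly as in route MarginalTypeI: for a Clay datum either HasGlobalKatoSolution ν u₀ — then the
fact gives the smooth bounded-energy
solution — or HardyTypeIExtraction (fed by HardyEnergyBound) gives a Hardy-bounded local Type-I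
singular point, ABForwardHardy turns it into
a Hardy-bounded Type-I ancient witness, contradicting NoHardyTypeIAncient. Verified sorry-free in
the planner's Sketch.lean (theorem
assembly_holds, axioms propext / Classical.choice / Quot.sound, 8 lines).

Rationale: WHY THIS LINE. Among critical quantities the Hardy energy is the one with an EXACT local balance law
whose dissipative side is strictly stronger than the
energy law's (the extra ν∫|∇u|²/r and the point sink 4πν|u(x₀,t)|²) and whose source has sign
structure (inflow of high head, anisotropic
part of Π only) — the currency in which one-sided regularity is already a theorem
(SereginSverak2002) and in which CKN1982 §8 proved the
small-data ancestor (Theorems C–D: ∫|u₀|²|x|⁻¹ small/finite ⇒ regularity on/near the t-axis, by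
testing the local energy inequality against
|x|⁻¹-type weights). The line removes CKN's smallness by routing a LARGE-but-bounded Hardy energy
through Type I: H dominates the scaled
energy A on every ball (A(Q(z,r)) ≤ sup_t H), Seregin2006 Lemma 2.1(c) (= Seregin2014 Prop 3.11(ii),
p.113) upgrades bounded A to
Albritton–Barker's 𝐈 < ∞, AlbrittonBarker2019 Thm 1.1 (forward) produces a mild bounded ancient
solution which inherits BOTH 𝐈 < ∞ and the
Hardy bound (scale-invariant, lower semicontinuous), and such "tail-free" profiles are what the
L³/L^{3,∞} Liouville theorems
(EscauriazaSereginSverak2003; AlbrittonBarker2019 Thm 1.2 and Thm 4.1) almost reach. Imported areas: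
potential theory (the fundamental
solution as test weight / Hardy's inequality), parabolic blow-up + Liouville rigidity (KNSS2009,
SereginSverak2009), ε-regularity
bookkeeping (Seregin2006); no probabilistic or spectral reformulation (none touches the ∀-datum
supercritical gap). Versus prior routes:
TypeILiouville's rate crux NoTypeII (stmt-0056) and MarginalTypeI's marginality crux (stmt-1748) are
replaced by ONE scalar field H with a
balance law to work with, and the shared Liouville half (L′) is weakened to Hardy-bounded profiles;
negatives index empty.

RANKED CRUXES. #0 Thesis (target) — X = HardyEnergyBound ∧ NoHardyTypeIAncient, as in § Thesis (decl
Thesis ↔ C2 ∧ C3 by Iff.rfl in Sketch.lean). (why it might fail: C2 is a critical a-priori bound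
from supercritical data (a Type-II or 1/|x|-tailed Type-I blow-up violates it); C3 dies with one
Hardy-bounded (tail-free) Type-I ancient profile, e.g. a fast-decaying backward DSS solution.)
[CKN1982, Seregin2006, AlbrittonBarker2019, KNSS2009, Tao2016AveragedNS]
#2 HardyEnergyBound (crux) — (card J1/X_J, local form) for ν > 0, a Clay datum u₀ (C^∞, div-free,
rapidly decaying), T > 0 and a Kato solution u of NS on [0,T) with u(0) = u₀ (IsKatoSolutionOn T ν
u₀ u): for every x* ∈ ℝ³ there are r₀ > 0 and K with ∫_{B(x*,r₀)} |u(t,x)|² / |x − x₀| dx ≤ K for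
all x₀ ∈ B(x*,r₀) and all t ∈ [0,T) with t > T − r₀². Trivial for T < T_max (u bounded near T); at T
= T_max it says every blow-up is Hardy-bounded, i.e. (by S0–S2) Type I in Albritton–Barker's sense
and tail-free. Tool: the point-sink balance law HardyBalanceLaw (S3) — K is the initial local Hardy
energy plus the cumulative head influx toward x₀. [difficulty: XL] (why it might fail: Critical
a-priori bound from supercritical data (EnergySupercriticality): the balance law's only source, the
head influx ∫Π u_r r⁻², is cubic and unsigned; a Type-II or 1/|x|-tailed Type-I blow-up (Hou's
scenario arXiv:2107.06509, if singular) breaks it.) [CKN1982, doi:10.1002/cpa.3160350604,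
SereginSverak2002, Seregin2012, Tao2016AveragedNS, Hou2022PotentiallySingularNS,
book:seregin2014-lecture-notes-regularity-theory-navier-stokes-equations p.113]
#3 NoHardyTypeIAncient (crux) — (card reading (iii), Liouville half) there is no triple (u,p,G)
with: u t a.e.-strongly measurable for t < 0, u a mild bounded ancient solution of NS (ν = 1) on
ℝ³×(−∞,0), (u,p) suitable weak on the slab (−∞,0)×ℝ³, G a weak spatial gradient of u there, u not
a.e. zero, Albritton–Barker 𝐈(ℝ³×ℝ₋) = typeIBound (Iio 0 ×ˢ univ) u p G < ∞, AND Hardy-bounded: ∃ K,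
∀ x₀, for a.e. s < 0, ∫ |u(s,y)|²/|y−x₀| dy ≤ K. = stmt-1749 (NoTypeIAncient, route MarginalTypeI)
with one extra hypothesis, hence closed in one line from (L′) or from KNSS (L) (in tree:
LiouvilleConjectureNS.not_nontrivialMildAncientTypeIExists_measurable); the extra clause kills every
profile with a C/|y| spatial tail (H sums the dyadic shells: ∫|U|²/|y| = ∞ for |U| ~ C/|y|), leaving
"bumps without tail", for which the natural endgame is the L³ / L^{3,∞}-along-a-sequence Liouville
theorems (AlbrittonBarker2019 Thm 1.2, Thm 4.1; ESS2003) once an envelope sup |y||u| < ∞ or L^{3,∞}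
control is extracted from 𝐈 < ∞ + Hardy. [difficulty: L] (why it might fail: One Hardy-bounded
Type-I ancient profile (e.g. a fast-decaying backward DSS solution; TypeIDSSLiouvilleConjecture is
open) refutes it; Hardy-boundedness alone gives neither L³ nor L^{3,∞} (sparse unit bumps), so A–B
Thm 1.2/4.1 and ESS do not apply verbatim.) [AlbrittonBarker2019, arXiv:1811.00502, KNSS2009,
SereginSverak2009, EscauriazaSereginSverak2003, NecasRuzickaSverak1996, Tsai1998,
ChaeWolf2017RemovingDSS, Seregin2020]
#9 ScaledEnergyControlsTypeI (support) — (Seregin2006 Lemma 2.1(c) / Seregin2014 Prop 3.11(ii), in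
Albritton–Barker's ball setting; fact-level) if (u,p) is a suitable weak solution in the parabolic
ball Q(z,r₀) (IsSuitableWeakSolutionInBall) and the esssup-scaled energy A(Q(z',r)) = cknAEss r z' u
is bounded by K over ALL parabolic sub-balls Q(z',r) ⊆ Q(z,r₀), then for some weak spatial gradient
G of u on Q(z,r₀), 𝐈(Q(z,r₀/2)) = typeIBound (Q(z,r₀/2)) u p G < ∞. Proof: Lemma 2.1(c) (sup_{r≤1} A
≤ A₀ ⇒ C^{4/3}(r) + D₀(r) + E(r) ≤ e(A₀)(r²(D₀(1)+E(1)) + 1), r ≤ 1/2) applied, after translation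
and scaling, at every centre z' ∈ Q(z,r₀/2) with top scale r₀/2 (Q(z',r₀/2) ⊆ Q(z,r₀), so D₀, E at
the top scale are bounded by those of Q(z,r₀) uniformly in z'). May be vendored as a named
Literature fact by the grounder. [difficulty: M] [Seregin2006, arXiv:math/0607537 Lemma 2.1(c) p.4,
Seregin2007Morrey, Seregin2014 Prop 3.11(ii) p.113, AlbrittonBarker2019 §1]
#9 HardyTypeIExtraction (support) — (card J4; known-result chain, the A-twin of stmt-1751) a Clay
datum u₀ without global Kato solution at viscosity ν whose Kato solutions all satisfy the local
Hardy bound of HardyEnergyBound yields a Hardy-bounded local Type-I singular point: ∃ r₀ z u p with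
IsLocalTypeISingularPoint r₀ z u p (ν = 1 after the rescaling v(s,y) = ν⁻¹u(s/ν,y), q = ν⁻²p(s/ν,·))
and ∃ K, ∀ x₀ ∈ B(z.2,r₀), for a.e. t ∈ (z.1−r₀², z.1), ∫_{B(z.2,r₀)} |u(t,x)|²/|x−x₀| dx ≤ K.
Chain: exists_singularPoint_katoMaximalTime / singular_point_of_not_hasGlobalKatoSolution
(RusinSverakSingularPoint.lean; named facts continuation_of_bounded + farField_bound =
Lemarierieusset2023 Thm 15.1, kato_local_holds proved) gives the Kato solution on [0,T_max) and a
backward singular point (T_max,x*); the Hardy bound near x* gives A(Q(z',r)) ≤ r⁻¹∫_{B(x',r)}|u|² ≤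
∫_{B(x*,r₀)}|u|²/|x−x'| ≤ K for all sub-balls; suitability + p ∈ L^{3/2} + weak gradient from
IsKatoSolutionOn.exists_rieszPressure_suitable_slab, the energy inequality (KatoLerayHopf) and p =
ℛℛ(u⊗u) ∈ L^{5/3}; ScaledEnergyControlsTypeI upgrades to 𝐈(Q(z,r₀/2)) < ∞; restrict to the half ball
(HasWeakSpatialGradientOn.mono). [difficulty: M] [Lemarierieusset2023 Thm 15.1, RusinSverak2011,
Seregin2006, AlbrittonBarker2019 Def 2.1, LemarieRieusset2016 Prop 6.5]
#9 ABForwardHardy (support) — (AlbrittonBarker2019 Thm 1.1 forward, carrying the Hardy bound) a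
Hardy-bounded local Type-I singular point (output of HardyTypeIExtraction) yields a NONTRIVIAL mild
bounded ancient solution (ν = 1) with a.e.-strongly measurable slices, suitable on (−∞,0)×ℝ³ with
pressure p and weak gradient G, typeIBound (Iio 0 ×ˢ univ) u p G < ∞, and sup_{x₀} ess-sup_{s<0} ∫
|u(s,y)|²/|y−x₀| dy ≤ K. Proof = A–B §3 verbatim (Prop 2.4: pass to an earlier singular point z*
inside the ball; Seregin–Šverák rescaling around near-maximum points z_k → z*, SereginSverak2009 Thm
2.8; 𝐈 inherited by lower semicontinuity) plus one remark: the local Hardy functional is invariant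
under the NS scaling and translation, the rescaled balls B((x_c − x_k)/λ_k, r₀/λ_k) exhaust ℝ³, and
∫_{B_R}|u_k|²/|y−x₀| is lower semicontinuous under the strong L³_loc convergence of Lemma 2.2
(Fatou), so the limit obeys ∫|U(s)|²/|y−x₀| ≤ K for every x₀ and a.e. s; measurability of slices
because the limit is a genuine KNSS mild bounded ancient solution, hence smooth (SereginSverak2009
Thm 2.4). Without the Hardy clause this is stmt-1752 (ABForwardMeasurable). [difficulty: L]
[AlbrittonBarker2019 Thm 1.1 + Prop 2.4 + Lemma 2.2 + §3, SereginSverak2009 Thm 2.4 + Thm 2.8,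
KNSS2009 §6]
#9 HardyBalanceLaw (support) — (card J3, the tool; provable now) for ν > 0 and a classical solution
(u,p) of unforced NS jointly smooth on [0,T]×ℝ³ (IsClassicalNSSolutionOn (Icc 0 T) ν 0 u p) with
uniform rapid spatial decay (HasUniformRapidDecayOn (Icc 0 T) u) and normalised pressure up to c(t)
(HasNormalisedPressure u p (Icc 0 T)), for every centre x₀ and 0 ≤ t₁ ≤ t₂ ≤ T: ∫|u(t₂)|²/|x−x₀| −
∫|u(t₁)|²/|x−x₀| = −2∫_{t₁}^{t₂} ( ν∫|∇u(s)|²/|x−x₀| + 2πν|u(s,x₀)|² + ∫ (|u|²/2 + p)(s,x) ⟨u(s,x),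
x−x₀⟩/|x−x₀|³ ) ds. Proof: multiply the pointwise identity ∂_t(|u|²/2) + div(uΠ) = νΔ(|u|²/2) −
ν|∇u|²_F by w = |x−x₀|⁻¹, integrate by parts (∇w = −(x−x₀)/|x−x₀|³; ∫ w Δf = −4π f(x₀) for decaying
smooth f, Δ(1/r) = −4πδ), and note ∫ c(s) ⟨u, x−x₀⟩/|x−x₀|³ = c(s)∫ w div u = 0; all integrands are
integrable by the decay hypothesis and local integrability of r⁻¹, r⁻² in ℝ³. [difficulty:
provable-now] [CKN1982 §2 and §8, MajdaBertozzi2002 Prop 1.13, Tao2011 Lemma 4.1,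
book:seregin2014-lecture-notes-regularity-theory-navier-stokes-equations]

TWO-LAYER PLAN. Foreseen glued splits, filed only after a crux moves (k ≤ 3, depth 1):
HardyEnergyBound ⇐ HeadInfluxBound (the cumulative anisotropic
head influx ∫∫ (Π−Π̄(r)) u_r r⁻² toward every point is locally bounded up to T) →
HardyBalanceLaw-for-Kato-solutions (the identity S3 along
the smooth Kato flow on (0,T), with cut-off) → HardyEnergyBound; NoHardyTypeIAncient ⇐ HardyEnvelope
(𝐈 < ∞ + Hardy bound ⇒ an
L^{3,∞} bound along a sequence s_k → −∞, or the envelope sup |y||u(y,s)| < ∞) → SequenceLiouville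
(AlbrittonBarker2019 Thm 1.2 / Thm 4.1
rendered as a named fact) → NoHardyTypeIAncient. A single-centre sibling of C2 (card T2: at every
backward singular point the Hardy
energy AT THAT CENTRE is unbounded — the Hardy analogue of Seregin2012's L³ → ∞) is the natural
layer-2 strengthening once C3 closes.

KILL CRITERIA. (i) A Kato solution from a Clay datum whose local Hardy energy is unbounded as t ↑
T_max (any Type-II or tailed Type-I singularity, e.g.
Hou2022PotentiallySingularNS if singular) refutes HardyEnergyBound — that is a finite-time
singularity of the physical solution; close
`refuted:HardyEnergyBound`. (ii) A nontrivial Hardy-bounded mild bounded ancient solution with 𝐈 < ∞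
(tail-free backward DSS / recurrent
Type-I profile) refutes NoHardyTypeIAncient — pivot: restrict C3 to ancient solutions that are
blow-up limits of Kato solutions from Clay
data (eternal, forward-global Hardy bound), else close. (iii) stmt-1749 (L′) or TypeILiouville's (L)
proved ⇒ C3 closes in one line;
NavierStokesRegularity proved elsewhere moots the route; ¬(L′) alone does NOT kill C3 (the witness
may be tailed).

NOT DECOMPOSED YET. How C2 is proved (no mechanism beyond the balance law: the sign structure of the
head influx, its control by the dissipative terms
ν∫|∇u|²/r + 4πν|u(x₀)|², a monotonicity or almost-monotonicity of t ↦ H after subtracting the influx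
— all layer-2); the envelope /
L^{3,∞} extraction inside C3; the class bookkeeping of S1 (ν-rescaling with anisotropic cylinders,
Riesz pressure in L^{5/3} up to T_max)
and of S2 (Fatou under L³_loc limits); the GLOBAL form of the card's X_J (sup over all x₀ ∈ ℝ³ and t
< T of ∫_{ℝ³}|u|²/|x−x₀|), which
implies C2 and is the form the balance law speaks about, is kept as the heuristic parent, not filed;
the quantitative necessary condition
J6 (Type-I(C) point ⇒ influx ≥ 4πC² log((δ/(T−t))^{1/2}) − O(1)) is a corollary of S3, not an item.

CHEAPEST FALSIFIER. Lookup first: Zhou, Proc. Roy. Soc. Edinburgh A 139 (2009) 661–671,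
doi:10.1017/s0308210507000790 (weighted regularity criteria
sup_{x₀} ‖|x−x₀|^β u‖_{L^α_t L^γ_x} < ∞, 2/α + 3/γ = 1 − β): the Hardy bound is the endpoint (β,α,γ)
= (−1/2, ∞, 2) of that scaling line —
if Zhou's admissible range included it, "Hardy-bounded ⇒ regular" would be KNOWN, C3/S0–S2 moot and
the route a one-crux restatement to be
restructured (paywalled here; acquisition acq-02507 filed; the planner's expectation is α < ∞ and β
≥ 0 there). Computation second: on
Hou's axisymmetric interior-layer data (arXiv:2107.06509) evaluate t ↦ sup_{x₀} ∫_{B}|u|²/|x−x₀| at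
the ring: logarithmic growth = tailed
Type I, power growth = Type II — either refutes C2 for that scenario if the singularity is real;
saturation supports C2. Junk audit done by
the planner: C2 is vacuous for T < T_max (u bounded ⇒ local H ≤ 8π r₀² ‖u‖²_∞) and has content
exactly at T_max (intended); C3's class
excludes KNSS parasitic fields u = b(t) (H = ∞) and every C/|y|-tailed profile, and is inhabited by
any hypothetical fast-decaying Type-I
profile — neither junk-true nor junk-false.

NUMBERS. Point-sink coefficient 4πν for H = ∫|u|²/r (Δ(1/r) = −4πδ; Seregin2014 / Gilbarg–Trudinger
(2.12)); A(Q(z,r)) ≤ sup_t ∫_{B(x*,r₀)}|u|²/|x−z.2|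
for B(z.2,r) ⊆ B(x*,r₀) (since r⁻¹ ≤ |x−z.2|⁻¹ on the ball); Seregin2006 Lemma 2.1(c): sup_{r≤1}A ≤
A₀ ⇒ C^{4/3}(r)+D₀(r)+E(r) ≤
e(A₀)(r²(D₀(1)+E(1))+1) for r ≤ 1/2; Type-I far field |u| ≈ C(|x−x₀|²+T−t)^{-1/2} gives H(x₀,t) ≈
2πC² log(1/(T−t)) (H sums the
log-many shells of scaled energy ≈ C² that A only sups) — the exact rate separating tailed Type I
(log) from Type II (power). Known cases of
C3: under (L)/(L′) (in tree), axisymmetric (Seregin2020, KNSS2009 Thm 5.2–5.3), self-similar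
profiles (NecasRuzickaSverak1996, Tsai1998).
Items at open: 8 (target, assembly, 2 cruxes, 4 support); new definitions 0.

DEFINITION REQUESTS. None (H and the influx are inline integrals over existing vocabulary:
IsKatoSolutionOn, IsLocalTypeISingularPoint, typeIBound, cknAEss,
IsSuitableWeakSolutionInBall, IsBoundedAncientMildSolution, IsClassicalNSSolutionOn,
HasUniformRapidDecayOn, HasNormalisedPressure,
frobeniusNormSq — all `lean check` rc 0 in Sketch.lean). Cite/fact wishes for grounders: Seregin2006
Lemma 2.1(c) as a named Literature fact
(S0 is its ball rendering); AlbrittonBarker2019 Thm 1.2 / Thm 4.1 (L³ / L^{3,∞} along a sequence ⇒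
0) as named facts for C3's layer 2;
acquisitions: CKN1982 full text (the held stub paper:doi-10-1002-cpa-3160350604 is MISFILED — a
different paper), Zhou 2009 (acq-02507).

Novelty: Searches (2026-08-15): `lit frontier NavierStokesRegularity --since 2021` (30 rows: non-uniqueness,
forward self-similar, ε-regularity,
"first-threshold" preprints — nothing on point-weighted energies); `lit search --source zbmath
"Navier-Stokes weighted energy singular
point"` (8, irrelevant), `"Navier-Stokes Hardy inequality weighted energy blow-up type I"` (0),
`"Zhou weighted regularity criteria
Navier-Stokes"` (1: doi:10.1017/s0308210507000790, the scaling family containing H as an endpoint —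
see Cheapest falsifier);
`lit search --hybrid` / `lit vsearch` over held books (Seregin2014, LemarieRieusset2016 ch. 13,
RobinsonRodrigoSadowski2016, Ożański's CKN
monograph: no |x−x₀|⁻¹-weighted blow-up analysis beyond CKN's Theorems C–D; Lemarié-Rieusset's
weighted theory uses (1+|x|)^{-γ} weights for
EXISTENCE); `lit galaxy search --star all` (title "Partial regularity of suitable weak solutions": 0
panama / noise pdf); `lit read`
Seregin2014 pp.112–114 (Prop 3.11), arXiv:math/0607537 p.4 (Lemma 2.1), arXiv:1811.00502 pp.3–4, 9
(Thms 1.1, 1.2, 4.1); in-tree scan of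
48 NS Theses (grep hardy|weighted: only Hardy-CONSTANT stretching spectra and (1+|x|)-type weights)
and of the card index (117 cards per the
card's own audit; OpenAlex/S2 rate-limited today, as for the card).
Nearest prior art found: CKN1982 = doi:10.1002/cpa.3160350604 §8 Theorems C–D (the |x|⁻¹-weighted
energy inequality WITH smallness /
with a partial conclusion); Seregin2006 (arXiv:math/0607537) Lemma 2.1(c) + Sere  [refs: 10.1017/s0308210507000790, 10.1002/cpa.3160350604, math/0607537, 1811.00502, doi:10.1017/s0308210507000790, doi:10.1002/cpa.3160350604, Seregin2014, LemarieRieusset2016, RobinsonRodrigoSadowski2016, CKN1982, Seregin2006, AlbrittonBarker2019]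

Barriers (technique_class: weighted-energy-identity liouville-rigidity type-I): - technique_class: weighted-energy-identity liouville-rigidity type-I
- Literature.Barriers.NavierStokesRegularity.EnergySupercriticality: NOT evaded at C2 — H is
critical and must be bounded from supercritical (energy-class) data; the bet is structure, not
coercivity: the balance law's source is a signed, anisotropic head flux (the currency of
SereginSverak2002's one-sided theorem) and its sink side is strictly stronger than the energy law's;
the frame (S0–S2, C3) is scale-invariant and never uses the energy coercively (finite energy enters
only to put the Riesz pressure in L^{5/3} ⊂ L^{3/2}_loc).
- Literature.Barriers.NavierStokesRegularity.TaoAveragedBlowup: conceded for any proof of C2 by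
abstract bilinear estimates — Tao's averaged blow-up is Type II (arXiv:1402.0290 p.8 fn.), so the
averaged analogue of C2 is presumably false; the balance law itself needs the EXACT local energy
flux div(uΠ) and the pointwise identity u·Δu = Δ|u|²/2 − |∇u|² tested against the fundamental
solution, structure an averaged bilinear form B̃ does not possess — evasion in form, the content bet
is that the signed head influx can be controlled using the true pressure.
- Literature.Barriers.NavierStokesRegularity.NavierStokesInequalitySingularSolution: bites the
INEQUALITY form — Scheffer's Navier–Stokes-inequality solutions satisfy the weighted local energy
inequality (CKN §8 style) yet blow up, so C2 cannot follow from the local energy inequality alone;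
the line uses the equation twice beyond it

Novelty grade: new-combination — ROUTE REVIEW refuter rreview-5bc268af 2026-08-15 — PASS, keep open (full text: my folder note_NS.txt). All 8 decls elaborate rc0 (W_NS.lean; Thesis↔C2∧C3 Iff.rfl); simp/aesop close nothing; no automated vacuity. C2 HardyEnergyBound 7979: content only at T=T_max; ¬C2 ⇒ Kato solution unbounded near (x (refuter refuter-rreview-route-AtomisticToContinu-5bc268af-0, 2026-08-15T14:04:49Z; prior: CKN1982 §8 Thm C-D doi:10.1002/cpa.3160350604; Seregin2006 arXiv:math/0607537 L2.1(c); AlbrittonBarker2019 arXiv:1811.00502; Zhou2009 doi:10.1017/s0308210507000790; stmt-NavierStokesRegularity-1749)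

History (route lifecycle, newest last):
- 2026-08-15T12:45:16Z · rev 1: restated HardyBalanceLaw (stmt-NavierStokesRegularity-7984) — restate support HardyBalanceLaw: replace the HasUniformRapidDecayOn/HasNormalisedPressure hypotheses (Schwartz decay is not propagated by NS: Brandolese instant (planner-plancard-NavierStokesRegularity-Navie-7be4ac4f-0)
- 2026-08-16T04:12:21Z · AUTO-CRUX (backfill): Thesis — hypotheses of the deciding theorem that nothing in the route derives are cruxes (operator:999:1085951)
- 2026-08-16T14:43:07Z · LINT AUTOFIX route.multi-assembly: kept Assembly, dropped Assembly2 (gate:hygiene)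
- 2026-08-16T15:12:26Z · rev 8: dropped stmt-NavierStokesRegularity-15486 — undo of the 15:10Z re-add: the gate rendered the re-filed support Assembly2 (stmt-15486) in the slot of the dropped stmt-7985, i.e. BEFORE the decls HardyTypeIE (planner-rbadge-NavierStokesRegularity-HardyPoi-e2f1f051-g3-0)

sub-problem: NavierStokesRegularity · status: open · opened planner-plancard-NavierStokesRegularity-Navie-7be4ac4f-0 2026-08-15T12:21:38Z · rev 9 · ledger route-NavierStokesRegularity-HardyPointSink
GENERATED by the gate from the ledger (D-0016/17). Provers cite these decls: `theorem foo : Summit.NavierStokesRegularity.NavierStokesRegularity.Theses.HardyPointSink.<Decl> := …` in Summits/NavierStokesRegularity/NavierStokesRegularity/Theorems/<Name>.lean.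
-/

namespace Summit.NavierStokesRegularity.NavierStokesRegularity.Theses.HardyPointSink

open scoped BigOperators Topology Manifold Classical MeasureTheory ProbabilityTheory Matrix InnerProductSpace ComplexConjugate ContinuousMap
open Filter Set Function TopologicalSpace MeasureTheory

attribute [summit_statement] _root_.NavierStokesRegularity

open Literature.NS

/-- item stmt-NavierStokesRegularity-7978 · target (kind.auto-crux: conjecture-grade) · rank 0 · open · by planner
why it might fail: X = C2 ∧ C3. C2 (critical sup-bound from supercritical data) breaks at any Type-II or C/(|x−x*|+√(T−t))-tailed Type-I blow-up (H ≳ 2πC² log 1/(T−t); Hou arXiv:2107.06509 if singular); C3 dies with one tail-free Type-I ancient profile (backward λ-DSS; TypeIDSSLiouvilleConjecture open).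
sources: CKN1982, doi:10.1017/s0308210507000790, arXiv:1311.4777, Tao2016AveragedNS, Hou2022PotentiallySingularNS, AlbrittonBarker2019
[target] X = HardyEnergyBound ∧ NoHardyTypeIAncient, as in § Thesis (decl Thesis ↔ C2 ∧ C3 by
Iff.rfl in Sketch.lean). -/
@[route_item "route-NavierStokesRegularity-HardyPointSink"]
def Thesis : Prop :=
  (∀ ν : ℝ, 0 < ν → ∀ u₀ : EuclideanSpace ℝ (Fin 3) → EuclideanSpace ℝ (Fin 3), ContDiff ℝ (⊤ : ℕ∞) u₀ → Literature.Analysis.FluidPDE.NSWave0.IsDivFree u₀ → Literature.Analysis.FluidPDE.HasRapidSpatialDecay u₀ → ∀ (T : ℝ) (u : ℝ → EuclideanSpace ℝ (Fin 3) → EuclideanSpace ℝ (Fin 3)), 0 < T → Literature.Analysis.FluidPDE.IsKatoSolutionOn T ν u₀ u → ∀ xs : EuclideanSpace ℝ (Fin 3), ∃ r₀ : ℝ, 0 < r₀ ∧ ∃ K : NNReal, ∀ x₀ ∈ Metric.ball xs r₀, ∀ t ∈ Set.Ico 0 T, T - r₀ ^ 2 < t → ∫⁻ x in Metric.ball xs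 r₀, ‖u t x‖ₑ ^ 2 / ‖x - x₀‖ₑ ≤ K) ∧ (¬ ∃ (u : ℝ → EuclideanSpace ℝ (Fin 3) → EuclideanSpace ℝ (Fin 3)) (p : ℝ → EuclideanSpace ℝ (Fin 3) → ℝ) (G : ℝ → EuclideanSpace ℝ (Fin 3) → EuclideanSpace ℝ (Fin 3) →L[ℝ] EuclideanSpace ℝ (Fin 3)), (∀ t < 0, MeasureTheory.AEStronglyMeasurable (u t) MeasureTheory.volume) ∧ Literature.Analysis.FluidPDE.IsBoundedAncientMildSolution 1 u ∧ Literature.Analysis.FluidPDE.IsSuitableWeakSolutionOn (Literature.Analysis.FluidPDE.slab (EuclideanSpace ℝ (Fin 3)) (Set.Iio 0) isOpen_Iio) 1 0 u p ∧ Literature.Analysis.FluidPDE.HasWeakSpatialGradientOn (Literature.Analysis.FluidPDE.slab (EuclideanSpace ℝ (Fin 3)) (Set.Iio 0) isOpen_Iio) u G ∧ ¬ (Function.uncurry u =ᵐ[MeasureTheory.volume.restrict (Set.Iio (0 : ℝ) ×ˢ (Set.univ : Set (EuclideanSpace ℝ (Fin 3))))] 0) ∧ Literature.Analysis.FluidPDE.typeIBound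 (Set.Iio (0 : ℝ) ×ˢ (Set.univ : Set (EuclideanSpace ℝ (Fin 3)))) u p G < ⊤ ∧ ∃ K : NNReal, ∀ x₀ : EuclideanSpace ℝ (Fin 3), ∀ᵐ t ∂(MeasureTheory.volume.restrict (Set.Iio (0 : ℝ))), ∫⁻ x, ‖u t x‖ₑ ^ 2 / ‖x - x₀‖ₑ ≤ K)

/-- item stmt-NavierStokesRegularity-7979 · crux · rank 2 · open · by planner
why it might fail: Critical sup-bound from supercritical data (EnergySupercriticality; source ∫Π u_r r⁻² cubic, unsigned): fails at ANY Type-II blow-up and any Type-I one with the generic C/(|x−x*|+√(T−t)) tail (H ≳ 2πC² log 1/(T−t)), e.g. Hou arXiv:2107.06509 if singular; only small H is known (Zhou 2009, CKN Thm C).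
sources: CKN1982, doi:10.1002/cpa.3160350604, doi:10.1017/s0308210507000790, arXiv:1311.4777, SereginSverak2002, Seregin2012
[crux] (card J1/X_J, local form) for ν > 0, a Clay datum u₀ (C^∞, div-free, rapidly decaying), T > 0
and a Kato solution u of NS on [0,T) with u(0) = u₀ (IsKatoSolutionOn T ν u₀ u): for every x* ∈ ℝ³
there are r₀ > 0 and K with ∫_{B(x*,r₀)} |u(t,x)|² / |x − x₀| dx ≤ K for all x₀ ∈ B(x*,r₀) and all t
∈ [0,T) with t > T − r₀². Trivial for T < T_max (u bounded near T); at T = T_max it says every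
blow-up is Hardy-bounded, i.e. (by S0–S2) Type I in Albritton–Barker's sense and tail-free. Tool:
the point-sink balance law HardyBalanceLaw (S3) — K is the initial local Hardy energy plus the
cumulative head influx toward x₀. [difficulty: XL] -/
@[route_item "route-NavierStokesRegularity-HardyPointSink", crux]
def HardyEnergyBound : Prop :=
  ∀ ν : ℝ, 0 < ν → ∀ u₀ : EuclideanSpace ℝ (Fin 3) → EuclideanSpace ℝ (Fin 3), ContDiff ℝ (⊤ : ℕ∞) u₀ → Literature.Analysis.FluidPDE.NSWave0.IsDivFree u₀ → Literature.Analysis.FluidPDE.HasRapidSpatialDecay u₀ → ∀ (T : ℝ) (u : ℝ → EuclideanSpace ℝ (Fin 3) → EuclideanSpace ℝ (Fin 3)), 0 < T → Literature.Analysis.FluidPDE.IsKatoSolutionOn T ν u₀ u → ∀ xs : EuclideanSpace ℝ (Fin 3), ∃ r₀ : ℝ, 0 < r₀ ∧ ∃ K : NNReal, ∀ x₀ ∈ Metric.ball xs r₀, ∀ t ∈ Set.Ico 0 T, T - r₀ ^ 2 < t → ∫⁻ x in Metric.ball xs r₀, ‖u t x‖ₑ ^ 2 / ‖x - x₀‖ₑ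 ≤ K

/-- item stmt-NavierStokesRegularity-7980 · crux · rank 3 · open · by planner
why it might fail: One tail-free Type-I ancient profile refutes it, e.g. a backward λ-DSS blow-up with o(|y|⁻¹) L²-averaged decay, λ outside Chae–Wolf's window: open (Bradshaw–Tsai OP 5.1 = TypeIDSSLiouvilleConjecture). Hardy + 𝐈<∞ give neither L³ along t_k→−∞ (A–B Thm 1.2) nor envelope (a): no Liouville thm applies.
sources: AlbrittonBarker2019, arXiv:1811.00502, KNSS2009, SereginSverak2009, EscauriazaSereginSverak2003, NecasRuzickaSverak1996
[crux] (card reading (iii), Liouville half) there is no triple (u,p,G) with: u t a.e.-strongly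
measurable for t < 0, u a mild bounded ancient solution of NS (ν = 1) on ℝ³×(−∞,0), (u,p) suitable
weak on the slab (−∞,0)×ℝ³, G a weak spatial gradient of u there, u not a.e. zero, Albritton–Barker
𝐈(ℝ³×ℝ₋) = typeIBound (Iio 0 ×ˢ univ) u p G < ∞, AND Hardy-bounded: ∃ K, ∀ x₀, for a.e. s < 0, ∫
|u(s,y)|²/|y−x₀| dy ≤ K. = stmt-1749 (NoTypeIAncient, route MarginalTypeI) with one extra
hypothesis, hence closed in one line from (L′) or from KNSS (L) (in tree:
LiouvilleConjectureNS.not_nontrivialMildAncientTypeIExists_measurable); the extra clause kills every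
profile with a C/|y| spatial tail (H sums the dyadic shells: ∫|U|²/|y| = ∞ for |U| ~ C/|y|), leaving
"bumps without tail", for which the natural endgame is the L³ / L^{3,∞}-along-a-sequence Liouville
theorems (AlbrittonBarker2019 Thm 1.2, Thm 4.1; ESS2003) once an envelope sup |y||u| < ∞ or L^{3,∞}
control is extracted from 𝐈 < ∞ + Hardy. [difficulty: L] -/
@[route_item "route-NavierStokesRegularity-HardyPointSink", crux]
def NoHardyTypeIAncient : Prop :=
  ¬ ∃ (u : ℝ → EuclideanSpace ℝ (Fin 3) → EuclideanSpace ℝ (Fin 3)) (p : ℝ → EuclideanSpace ℝ (Fin 3) → ℝ) (G : ℝ → EuclideanSpace ℝ (Fin 3) → EuclideanSpace ℝ (Fin 3) →L[ℝ] EuclideanSpace ℝ (Fin 3)), (∀ t < 0, MeasureTheory.AEStronglyMeasurable (u t) MeasureTheory.volume) ∧ Literature.Analysis.FluidPDE.IsBoundedAncientMildSolution 1 u ∧ Literature.Analysis.FluidPDE.IsSuitableWeakSolutionOn (Literature.Analysis.FluidPDE.slab (EuclideanSpace ℝ (Fin 3)) (Set.Iio 0) isOpen_Iio) 1 0 u p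 ∧ Literature.Analysis.FluidPDE.HasWeakSpatialGradientOn (Literature.Analysis.FluidPDE.slab (EuclideanSpace ℝ (Fin 3)) (Set.Iio 0) isOpen_Iio) u G ∧ ¬ (Function.uncurry u =ᵐ[MeasureTheory.volume.restrict (Set.Iio (0 : ℝ) ×ˢ (Set.univ : Set (EuclideanSpace ℝ (Fin 3))))] 0) ∧ Literature.Analysis.FluidPDE.typeIBound (Set.Iio (0 : ℝ) ×ˢ (Set.univ : Set (EuclideanSpace ℝ (Fin 3)))) u p G < ⊤ ∧ ∃ K : NNReal, ∀ x₀ : EuclideanSpace ℝ (Fin 3), ∀ᵐ t ∂(MeasureTheory.volume.restrict (Set.Iio (0 : ℝ))), ∫⁻ x, ‖u t x‖ₑ ^ 2 / ‖x - x₀‖ₑ ≤ K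

/-- item stmt-NavierStokesRegularity-7981 · support · rank 9 · closed · proved by Summit.NavierStokesRegularity.NavierStokesRegularity.Theorems.hardyPointSink_scaledEnergyControlsTypeI_proof (prover) · by planner
sources: Seregin2006, arXiv:math/0607537 Lemma 2.1(c) p.4, Seregin2007Morrey, Seregin2014 Prop 3.11(ii) p.113, AlbrittonBarker2019 §1
[support] (Seregin2006 Lemma 2.1(c) / Seregin2014 Prop 3.11(ii), in Albritton–Barker's ball setting;
fact-level) if (u,p) is a suitable weak solution in the parabolic ball Q(z,r₀)
(IsSuitableWeakSolutionInBall) and the esssup-scaled energy A(Q(z',r)) = cknAEss r z' u is bounded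
by K over ALL parabolic sub-balls Q(z',r) ⊆ Q(z,r₀), then for some weak spatial gradient G of u on
Q(z,r₀), 𝐈(Q(z,r₀/2)) = typeIBound (Q(z,r₀/2)) u p G < ∞. Proof: Lemma 2.1(c) (sup_{r≤1} A ≤ A₀ ⇒
C^{4/3}(r) + D₀(r) + E(r) ≤ e(A₀)(r²(D₀(1)+E(1)) + 1), r ≤ 1/2) applied, after translation and
scaling, at every centre z' ∈ Q(z,r₀/2) with top scale r₀/2 (Q(z',r₀/2) ⊆ Q(z,r₀), so D₀, E at the
top scale are bounded by those of Q(z,r₀) uniformly in z'). May be vendored as a named Literature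
fact by the grounder. [difficulty: M] -/
@[route_item "route-NavierStokesRegularity-HardyPointSink"]
def ScaledEnergyControlsTypeI : Prop :=
  ∀ (r₀ : ℝ) (z : ℝ × EuclideanSpace ℝ (Fin 3)) (u : ℝ → EuclideanSpace ℝ (Fin 3) → EuclideanSpace ℝ (Fin 3)) (p : ℝ → EuclideanSpace ℝ (Fin 3) → ℝ), 0 < r₀ → Literature.Analysis.FluidPDE.IsSuitableWeakSolutionInBall r₀ z u p → (∃ K : NNReal, ∀ r : ℝ, 0 < r → ∀ z' : ℝ × EuclideanSpace ℝ (Fin 3), Literature.Analysis.FluidPDE.parabolicCylinder r z' ⊆ Literature.Analysis.FluidPDE.parabolicCylinder r₀ z → Literature.Analysis.FluidPDE.cknAEss r z' u ≤ K) → ∃ G : ℝ → EuclideanSpace ℝ (Fin 3) → EuclideanSpace ℝ (Fin 3) →L[ℝ] EuclideanSpace ℝ (Fin 3), Literature.Analysis.FluidPDE.HasWeakSpatialGradientOn (Literature.Analysis.FluidPDE.parabolicCylinderOpens r₀ z) u G ∧ Literature.Analysis.FluidPDE.typeIBound (Literature.Analysis.FluidPDE.parabolicCylinder (r₀ / 2)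 z) u p G < ⊤

/-- item stmt-NavierStokesRegularity-7982 · support · rank 9 · closed · proved by Summit.NavierStokesRegularity.NavierStokesRegularity.Theorems.hardyTypeIExtraction_proof @ 15fe79a35f3a (prover) · by planner
sources: Lemarierieusset2023 Thm 15.1, RusinSverak2011, Seregin2006, AlbrittonBarker2019 Def 2.1, LemarieRieusset2016 Prop 6.5
[support] (card J4; known-result chain, the A-twin of stmt-1751) a Clay datum u₀ without global Kato
solution at viscosity ν whose Kato solutions all satisfy the local Hardy bound of HardyEnergyBound
yields a Hardy-bounded local Type-I singular point: ∃ r₀ z u p with IsLocalTypeISingularPoint r₀ z u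
p (ν = 1 after the rescaling v(s,y) = ν⁻¹u(s/ν,y), q = ν⁻²p(s/ν,·)) and ∃ K, ∀ x₀ ∈ B(z.2,r₀), for
a.e. t ∈ (z.1−r₀², z.1), ∫_{B(z.2,r₀)} |u(t,x)|²/|x−x₀| dx ≤ K. Chain:
exists_singularPoint_katoMaximalTime / singular_point_of_not_hasGlobalKatoSolution
(RusinSverakSingularPoint.lean; named facts continuation_of_bounded + farField_bound =
Lemarierieusset2023 Thm 15.1, kato_local_holds proved) gives the Kato solution on [0,T_max) and a
backward singular point (T_max,x*); the Hardy bound near x* gives A(Q(z',r)) ≤ r⁻¹∫_{B(x',r)}|u|² ≤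
∫_{B(x*,r₀)}|u|²/|x−x'| ≤ K for all sub-balls; suitability + p ∈ L^{3/2} + weak gradient from
IsKatoSolutionOn.exists_rieszPressure_suitable_slab, the energy inequality (KatoLerayHopf) and p =
ℛℛ(u⊗u) ∈ L^{5/3}; ScaledEnergyControlsTypeI upgrades to 𝐈(Q(z,r₀/2)) < ∞; restrict to the half ball
(HasWeakSpatialGradientOn.mono). [difficulty: M] -/
@[route_item "route-NavierStokesRegularity-HardyPointSink", crux]
def HardyTypeIExtraction : Prop :=
  ∀ ν : ℝ, 0 < ν → ∀ u₀ : EuclideanSpace ℝ (Fin 3) → EuclideanSpace ℝ (Fin 3), ContDiff ℝ (⊤ : ℕ∞) u₀ → Literature.Analysis.FluidPDE.NSWave0.IsDivFree u₀ → Literature.Analysis.FluidPDE.HasRapidSpatialDecay u₀ → ¬ Literature.Analysis.FluidPDE.HasGlobalKatoSolution ν u₀ → (∀ (T : ℝ) (u : ℝ → EuclideanSpace ℝ (Fin 3) → EuclideanSpace ℝ (Fin 3)), 0 < T → Literature.Analysis.FluidPDE.IsKatoSolutionOn T ν u₀ u → ∀ xs : EuclideanSpace ℝ (Fin 3), ∃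 r₀ : ℝ, 0 < r₀ ∧ ∃ K : NNReal, ∀ x₀ ∈ Metric.ball xs r₀, ∀ t ∈ Set.Ico 0 T, T - r₀ ^ 2 < t → ∫⁻ x in Metric.ball xs r₀, ‖u t x‖ₑ ^ 2 / ‖x - x₀‖ₑ ≤ K) → ∃ (r₀ : ℝ) (z : ℝ × EuclideanSpace ℝ (Fin 3)) (u : ℝ → EuclideanSpace ℝ (Fin 3) → EuclideanSpace ℝ (Fin 3)) (p : ℝ → EuclideanSpace ℝ (Fin 3) → ℝ), Literature.Analysis.FluidPDE.IsLocalTypeISingularPoint r₀ z u p ∧ ∃ K : NNReal, ∀ x₀ ∈ Metric.ball z.2 r₀, ∀ᵐ t ∂(MeasureTheory.volume.restrict (Set.Ioo (z.1 - r₀ ^ 2) z.1)), ∫⁻ x in Metric.ball z.2 r₀, ‖u t x‖ₑ ^ 2 / ‖x - x₀‖ₑ ≤ K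

/-- item stmt-NavierStokesRegularity-7983 · support · rank 9 · closed · proved by Summit.NavierStokesRegularity.NavierStokesRegularity.Theorems.abForwardHardy_proof @ 1837484111db (prover) · by planner
sources: AlbrittonBarker2019 Thm 1.1 + Prop 2.4 + Lemma 2.2 + §3, SereginSverak2009 Thm 2.4 + Thm 2.8, KNSS2009 §6
[support] (AlbrittonBarker2019 Thm 1.1 forward, carrying the Hardy bound) a Hardy-bounded local
Type-I singular point (output of HardyTypeIExtraction) yields a NONTRIVIAL mild bounded ancient
solution (ν = 1) with a.e.-strongly measurable slices, suitable on (−∞,0)×ℝ³ with pressure p and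
weak gradient G, typeIBound (Iio 0 ×ˢ univ) u p G < ∞, and sup_{x₀} ess-sup_{s<0} ∫ |u(s,y)|²/|y−x₀|
dy ≤ K. Proof = A–B §3 verbatim (Prop 2.4: pass to an earlier singular point z* inside the ball;
Seregin–Šverák rescaling around near-maximum points z_k → z*, SereginSverak2009 Thm 2.8; 𝐈 inherited
by lower semicontinuity) plus one remark: the local Hardy functional is invariant under the NS
scaling and translation, the rescaled balls B((x_c − x_k)/λ_k, r₀/λ_k) exhaust ℝ³, and
∫_{B_R}|u_k|²/|y−x₀| is lower semicontinuous under the strong L³_loc convergence of Lemma 2.2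
(Fatou), so the limit obeys ∫|U(s)|²/|y−x₀| ≤ K for every x₀ and a.e. s; measurability of slices
because the limit is a genuine KNSS mild bounded ancient solution, hence smooth (SereginSverak2009
Thm 2.4). Without the Hardy clause this is stmt-1752 (ABForwardMeasurable). [difficulty: L] -/
@[route_item "route-NavierStokesRegularity-HardyPointSink", crux]
def ABForwardHardy : Prop :=
  (∃ (r₀ : ℝ) (z : ℝ × EuclideanSpace ℝ (Fin 3)) (u : ℝ → EuclideanSpace ℝ (Fin 3) → EuclideanSpace ℝ (Fin 3)) (p : ℝ → EuclideanSpace ℝ (Fin 3) → ℝ), Literature.Analysis.FluidPDE.IsLocalTypeISingularPoint r₀ z u p ∧ ∃ K : NNReal, ∀ x₀ ∈ Metric.ball z.2 r₀, ∀ᵐ t ∂(MeasureTheory.volume.restrict (Set.Ioo (z.1 - r₀ ^ 2) z.1)), ∫⁻ x in Metric.ball z.2 r₀, ‖u t x‖ₑ ^ 2 / ‖x - x₀‖ₑ ≤ K) → ∃ (u : ℝ → EuclideanSpace ℝ (Fin 3) → EuclideanSpace ℝ (Fin 3)) (p : ℝ → EuclideanSpace ℝ (Fin 3) → ℝ) (G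 : ℝ → EuclideanSpace ℝ (Fin 3) → EuclideanSpace ℝ (Fin 3) →L[ℝ] EuclideanSpace ℝ (Fin 3)), (∀ t < 0, MeasureTheory.AEStronglyMeasurable (u t) MeasureTheory.volume) ∧ Literature.Analysis.FluidPDE.IsBoundedAncientMildSolution 1 u ∧ Literature.Analysis.FluidPDE.IsSuitableWeakSolutionOn (Literature.Analysis.FluidPDE.slab (EuclideanSpace ℝ (Fin 3)) (Set.Iio 0) isOpen_Iio) 1 0 u p ∧ Literature.Analysis.FluidPDE.HasWeakSpatialGradientOn (Literature.Analysis.FluidPDE.slab (EuclideanSpace ℝ (Fin 3)) (Set.Iio 0) isOpen_Iio) u G ∧ ¬ (Function.uncurry u =ᵐ[MeasureTheory.volume.restrict (Set.Iio (0 : ℝ) ×ˢ (Set.univ : Set (EuclideanSpace ℝ (Fin 3))))] 0) ∧ Literature.Analysis.FluidPDE.typeIBound (Set.Iio (0 : ℝ) ×ˢ (Set.univ : Set (EuclideanSpace ℝ (Fin 3)))) u p G < ⊤ ∧ ∃ K : NNReal, ∀ x₀ : EuclideanSpace ℝ (Fin 3), ∀ᵐ t ∂(MeasureTheory.volume.restrict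 (Set.Iio (0 : ℝ))), ∫⁻ x, ‖u t x‖ₑ ^ 2 / ‖x - x₀‖ₑ ≤ K

-- earlier HardyBalanceLaw (stmt-NavierStokesRegularity-7984, replaced 2026-08-15T12:45:16Z -> stmt-NavierStokesRegularity-8388): retired by None — ∀ (ν T : ℝ), 0 < ν → 0 < T → ∀ (u : ℝ → EuclideanSpace ℝ (Fin 3) → EuclideanSpace ℝ (Fin 3)) (p : ℝ → EuclideanSpace ℝ (Fin 3) → ℝ), Literature.Analysis.FluidPDE.IsClassicalNSSolutionOn (Set.Icc 0 T) ν 0 u p → Literature.Analysis.FluidPDE.HasUniformRapidD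
/-- item stmt-NavierStokesRegularity-8388 · support · rank 9 · closed · proved by Summit.NavierStokesRegularity.NavierStokesRegularity.Theorems.hardyPointSink_hardyBalanceLaw_proof @ f271614a0874 (prover) · by planner
sources: CKN1982 §2 and §8, MajdaBertozzi2002 Prop 1.13, Tao2011 Lemma 4.1, book:seregin2014-lecture-notes-regularity-theory-navier-stokes-equations
[support] (card J3, the tool; provable now) POINT-SINK BALANCE LAW for the Hardy energy. For nu>0
and a classical solution (u,p) of unforced NS jointly smooth on [0,T]xR^3 (IsClassicalNSSolutionOn
(Icc 0 T) nu 0 u p) with NS-realistic polynomial decay, uniformly in t: (1+|x|)^2 (|u|+|grad u|) +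
(1+|x|) |u_t| + |p| <= C (generic velocity decay from well-localised data is exactly |x|^{-4},
Brandolese; the pressure tends to a constant c(t), which drops out because int c <u, x-x0>/|x-x0|^3
= -c int div(u)/|x-x0| = 0), for every centre x0 and 0 <= t1 <= t2 <= T: int |u(t2)|^2/|x-x0| - int
|u(t1)|^2/|x-x0| = -2 int_{t1}^{t2} ( nu int |grad u(s)|_F^2/|x-x0| + 2 pi nu |u(s,x0)|^2 + int
(|u|^2/2 + p)(s,x) <u(s,x), x-x0>/|x-x0|^3 ) ds. Proof: multiply the pointwise identity d_t(|u|^2/2)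
+ div(u Pi) = nu Lap(|u|^2/2) - nu |grad u|_F^2 (Pi = |u|^2/2 + p) by w = |x-x0|^{-1}, integrate by
parts on R^3 minus B_eps(x0) and let eps -> 0, R -> oo (grad w = -(x-x0)/|x-x0|^3; int w Lap f = -4
pi f(x0) for such f, Lap(1/r) = -4 pi delta); the decay hypothesis makes every integrand O(|x|^{-4})
at infinity and dominates d/dt under the integral. Replaces the HasUniformRapidDecayOn version
(Schwartz decay -/
@[route_item "route-NavierStokesRegularity-HardyPointSink"]
def HardyBalanceLaw : Prop :=
  ∀ (ν T : ℝ), 0 < ν → 0 < T → ∀ (u : ℝ → EuclideanSpace ℝ (Fin 3) → EuclideanSpace ℝ (Fin 3)) (p : ℝ → EuclideanSpace ℝ (Fin 3) → ℝ), Literature.Analysis.FluidPDE.IsClassicalNSSolutionOn (Set.Icc 0 T) ν 0 u p → (∃ C : ℝ, ∀ t ∈ Set.Icc 0 T, ∀ x : EuclideanSpace ℝ (Fin 3), (1 + ‖x‖) ^ 2 * (‖u t x‖ + ‖fderiv ℝ (u t) x‖) + (1 + ‖x‖) * ‖Literature.Analysis.FluidPDE.timeDerivWithin (Set.Icc 0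 T) u t x‖ + |p t x| ≤ C) → ∀ (x₀ : EuclideanSpace ℝ (Fin 3)) (t₁ t₂ : ℝ), 0 ≤ t₁ → t₁ ≤ t₂ → t₂ ≤ T → (∫ x, ‖u t₂ x‖ ^ 2 / ‖x - x₀‖) - (∫ x, ‖u t₁ x‖ ^ 2 / ‖x - x₀‖) = - 2 * ∫ s in t₁..t₂, (ν * (∫ x, Literature.Analysis.FluidPDE.frobeniusNormSq (fderiv ℝ (u s) x) / ‖x - x₀‖) + 2 * Real.pi * ν * ‖u s x₀‖ ^ 2 + ∫ x, (‖u s x‖ ^ 2 / 2 + p s x) * inner ℝ (u s x) (x - x₀) / ‖x - x₀‖ ^ 3)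

/-- item stmt-NavierStokesRegularity-9116 · support · rank 9 · closed · proved by Summit.NavierStokesRegularity.NavierStokesRegularity.Theorems.hardyPointSink_blowupHasSingularPoint_proof @ 657f3200cf4f (prover) · by planner
[support] (generic, provable now from the tree; route-repair rev 2) LOSS OF SMOOTHNESS HAPPENS AT A
POINT: for ν>0, T>0 and a classical unforced NS solution (u,p) on ℝ³×[0,T) (IsClassicalNSSolutionOn
(Ico 0 T) ν 0 u p) which is Leray–Hopf on [0,T) from the rapidly decaying datum u 0, if u has no
smooth extension past T (¬HasSmoothExtensionPast ν 0 u T) then some xs ∈ ℝ³ is a backward singular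
point at time T: u is essentially unbounded on every parabolic cylinder Q_r(T,xs) =
(T−r²,T)×B(xs,r), r>0 (this is IsBackwardSingularPoint u (T,xs), inlined so that the route stays
inside the clean cone ClassicalSolution+LerayHopf+SuitableWeak+NSWave0). Proof: the contrapositive
of the PROVED hasSmoothExtensionPast_of_bounded_holds (KNSSTypeIIHolds.lean) gives sup over [0,T)×ℝ³
of |u| = ∞; u is the Kato solution of its datum on [0,T) (weak–strong uniqueness, kato_unique_holds)
and T is its maximal Kato time (a Kato solution on a longer interval is bounded near T);
lemarieRieusset_singular_point_of_blowup_holds / rusin_sverak_singular_point_of_blowup_holds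
(KatoFarFieldBound.lean: far-field regularity + compactness of the closed ball) give xs for r² < T,
and eLpNorm ∞ is monotone in the cylinde -/
@[route_item "route-NavierStokesRegularity-HardyPointSink"]
def BlowupHasSingularPoint : Prop :=
  ∀ (ν T : ℝ), 0 < ν → 0 < T → ∀ (u : ℝ → EuclideanSpace ℝ (Fin 3) → EuclideanSpace ℝ (Fin 3)) (p : ℝ → EuclideanSpace ℝ (Fin 3) → ℝ), Literature.Analysis.FluidPDE.IsClassicalNSSolutionOn (Set.Ico 0 T) ν 0 u p → Literature.Analysis.FluidPDE.IsLerayHopfOn T ν 0 (u 0) u → Literature.Analysis.FluidPDE.HasRapidSpatialDecay (u 0) → ¬ Literature.Analysis.FluidPDE.HasSmoothExtensionPast ν 0 u T → ∃ xs : EuclideanSpace ℝ (Fin 3), ∀ r : ℝ, 0 < r → MeasureTheory.eLpNorm (Function.uncurry u) ⊤ (MeasureTheory.volume.restrict (Literature.Analysis.FluidPDE.parabolicCylinder r (T, xs))) = ⊤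

/-- item stmt-NavierStokesRegularity-9138 · support · rank 9 · closed · proved by Summit.NavierStokesRegularity.NavierStokesRegularity.Theorems.hardyAncientLimit_proof @ 145e703695b4 (prover) · by planner
[support] (Albritton–Barker FORWARD direction CARRYING THE HARDY BOUND, stated over a classical
solution; route-repair rev 2: replaces HardyTypeIExtraction + ABForwardHardy +
ScaledEnergyControlsTypeI of rev 1, whose LocalTypeI/Kato vocabulary dragged 12 unproved named facts
into the import cone) for ν, T, (u,p) as in the frame (classical on [0,T), Leray–Hopf on [0,T),
rapidly decaying datum), a backward singular point (T,xs) (output of BlowupHasSingularPoint) and a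
local Hardy bound ∫_{B(xs,r₀)}|u(t,x)|²/|x−x₀|dx ≤ K for all x₀ ∈ B(xs,r₀), t ∈ [0,T) with t > T−r₀²
(output of HardyEnergyBound): there is a HARDY-BOUNDED TYPE-I ANCIENT PROFILE, i.e. the object
NoHardyTypeIAncient forbids — (U,P) classical on ℝ³×(−∞,0) with ν = 1, U bounded, U ≢ 0,
Albritton–Barker's 𝐈(ℝ³×ℝ₋) < ∞ written INLINE over the accepted SuitableWeak quantities (cknA [sup
= esssup for smooth U] + cknC + the mean-free pressure term of cknDOsc verbatim + cknE with G = ∇U,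
sup over all parabolic balls Q(z,r) ⊆ ℝ³×ℝ₋), and sup_{x₀, s<0} ∫|U(s,y)|²/|y−x₀|dy ≤ K'. Proof
chain: (i) rescale viscosity to 1 (IsClassicalNSSolutionOn.nsRescale_holds /
ClassicalSolutionRescale; Hardy constant becomes K/ν²); (ii) on Q((T,xs -/
@[route_item "route-NavierStokesRegularity-HardyPointSink"]
def HardyAncientLimit : Prop :=
  ∀ (ν T : ℝ), 0 < ν → 0 < T → ∀ (u : ℝ → EuclideanSpace ℝ (Fin 3) → EuclideanSpace ℝ (Fin 3)) (p : ℝ → EuclideanSpace ℝ (Fin 3) → ℝ), Literature.Analysis.FluidPDE.IsClassicalNSSolutionOn (Set.Ico 0 T) ν 0 u p → Literature.Analysis.FluidPDE.IsLerayHopfOn T ν 0 (u 0) u → Literature.Analysis.FluidPDE.HasRapidSpatialDecay (u 0) → ∀ xs : EuclideanSpace ℝ (Fin 3), (∀ r : ℝ, 0 < r → MeasureTheory.eLpNorm (Function.uncurry u) ⊤ (MeasureTheory.volume.restrict (Literature.Analysis.FluidPDE.parabolicCylinder r (T, xs))) = ⊤) → ∀ (r₀ : ℝ) (K : NNReal),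 0 < r₀ → (∀ x₀ ∈ Metric.ball xs r₀, ∀ t ∈ Set.Ico 0 T, T - r₀ ^ 2 < t → ∫⁻ x in Metric.ball xs r₀, ‖u t x‖ₑ ^ 2 / ‖x - x₀‖ₑ ≤ K) → ∃ (U : ℝ → EuclideanSpace ℝ (Fin 3) → EuclideanSpace ℝ (Fin 3)) (P : ℝ → EuclideanSpace ℝ (Fin 3) → ℝ), Literature.Analysis.FluidPDE.IsClassicalNSSolutionOn (Set.Iio 0) 1 0 U P ∧ (∃ M : ℝ, ∀ t < 0, ∀ x : EuclideanSpace ℝ (Fin 3), ‖U t x‖ ≤ M) ∧ (∃ t < 0, ∃ x : EuclideanSpace ℝ (Fin 3), U t x ≠ 0) ∧ (⨆ (r : ℝ) (_ : 0 < r) (z : ℝ × EuclideanSpace ℝ (Fin 3)) (_ : Literature.Analysis.FluidPDE.parabolicCylinder r z ⊆ Set.Iio (0 : ℝ) ×ˢ (Set.univ : Set (EuclideanSpace ℝ (Fin 3)))), Literature.Analysis.FluidPDE.cknA r z U + Literature.Analysis.FluidPDE.cknC r z U + (ENNReal.ofReal r ^ 2)⁻¹ * (∫⁻ w in Literature.Analysis.FluidPDE.parabolicCylinder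 r z, ‖P w.1 w.2 - ⨍ y in Metric.ball z.2 r, P w.1 y‖ₑ ^ (3 / 2 : ℝ)) + Literature.Analysis.FluidPDE.cknE r z (fun t x => fderiv ℝ (U t) x)) < ⊤ ∧ (∃ K : NNReal, ∀ x₀ : EuclideanSpace ℝ (Fin 3), ∀ t < 0, ∫⁻ x, ‖U t x‖ₑ ^ 2 / ‖x - x₀‖ₑ ≤ K)

/-- item stmt-NavierStokesRegularity-0055 · assembly · rank 9 · closed · proved by Summit.NavierStokesRegularity.NavierStokesRegularity.Theorems.typeICertificateLadder_noBlowupToClay_proof @ f501e9774e4d (prover) · by planner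
Given NoBlowup, build the Clay (A) solution: local finite-energy classical solution for smooth
divergence-free rapidly decaying data (Leray 1934 §III / Fujita–Kato 1964 + LPS smoothing), continue
past every T using NoBlowup, glue by weak–strong uniqueness (Prodi–Serrin), bounded energy from the
energy inequality, and convert with
Literature.Analysis.FluidPDE.isNavierStokesSolution_and_smooth_iff. Blow-up at spatial infinity is
excluded by CKN ε-regularity applied far out. May take named Literature facts (leray_existence_R3,
ladyzhenskaya_prodi_serrin, weak_strong_uniqueness, fujita_kato_local) as hypotheses if the grounder
so rules. -/
@[route_item "route-NavierStokesRegularity-HardyPointSink"]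
def Assembly : Prop :=
  (∀ (ν T : ℝ), 0 < ν → 0 < T → ∀ (u : ℝ → EuclideanSpace ℝ (Fin 3) → EuclideanSpace ℝ (Fin 3)) (p : ℝ → EuclideanSpace ℝ (Fin 3) → ℝ), Literature.Analysis.FluidPDE.IsClassicalNSSolutionOn (Set.Ico 0 T) ν 0 u p → Literature.Analysis.FluidPDE.IsLerayHopfOn T ν 0 (u 0) u → Literature.Analysis.FluidPDE.HasRapidSpatialDecay (u 0) → Literature.Analysis.FluidPDE.HasSmoothExtensionPast ν 0 u T) → NavierStokesRegularity

/-- `Assembly` holds: proved by `Summit.NavierStokesRegularity.NavierStokesRegularity.Theorems.typeICertificateLadder_noBlowupToClay_proof` @ f501e9774e4d. -/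
theorem Assembly_holds : Assembly := _root_.Summit.NavierStokesRegularity.NavierStokesRegularity.Theorems.typeICertificateLadder_noBlowupToClay_proof

-- records of items no longer active in this route (dropped / restated):
-- earlier Assembly2 (stmt-NavierStokesRegularity-7985, dropped 2026-08-16T14:43:07Z): proved by Summit.NavierStokesRegularity.NavierStokesRegularity.Theorems.hardyPointSink_assembly2_proof — HardyEnergyBound → NoHardyTypeIAncient → HardyTypeIExtraction → ABForwardHardy → NavierStokesRegularity

/-! D-0027 §2.1 — DECIDING THEOREM (planner-authored via `route open/edit --closes-file`; by planner-rbadge-NavierStokesRegularity-HardyPoi-e2f1f051-g3-0 2026-08-16T15:05:34Z):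
its hypotheses are this route's items and its conclusion the sub-problem Statement (glue_lint), and it elaborates with this file. -/

/-- DECIDING THEOREM (D-0027 §2.1), rev-5 form (route-repair 2026-08-16: the hygiene lint dropped the
duplicate assembly item `Assembly2`, which the interim rev-2 `closes` took as a hypothesis; its four-line
proof is now inlined here). Hypotheses: the two cruxes `HardyEnergyBound` (C2), `NoHardyTypeIAncient` (C3)
and the two supports `HardyTypeIExtraction` (S1, proved in Theorems/HardyPointSinkHardyTypeIExtraction)
and `ABForwardHardy` (S2). Frame #0: the cruxes are literally the thesis `X = C2 ∧ C3` (`Thesis`,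
anonymous constructor). Frame #1 (`X → NavierStokesRegularity`): pure logic over the Kato dichotomy plus
the PROVED tree fact `Literature.Analysis.FluidPDE.clay_solution_of_hasGlobalKatoSolution_holds`
(NSKatoToClayHolds.lean, in this file's import cone via TypeICertificateLadderNoBlowupToClay): for a
Clay datum `u₀` and `ν > 0`, either `HasGlobalKatoSolution ν u₀` — then the fact gives the jointly
smooth bounded-energy solution — or S1 (fed with the local Hardy bound that C2 supplies for every Kato
solution from `u₀`) yields a Hardy-bounded local Type-I singular point, S2 turns it into a
Hardy-bounded Type-I mild bounded ancient witness, and C3 forbids that witness. -/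
@[closes "route-NavierStokesRegularity-HardyPointSink"] theorem closes (hE : HardyEnergyBound) (hN : NoHardyTypeIAncient)
    (hX : HardyTypeIExtraction) (hAB : ABForwardHardy) : _root_.NavierStokesRegularity := by
  -- frame #0: the thesis X = C2 ∧ C3 is realised by the two cruxes (definitionally)
  have hT : Thesis := ⟨hE, hN⟩
  -- frame #1: X → Statement
  show Literature.NS.NavierStokesExistenceSmoothR3
  intro ν hν u₀ hsm hdiv hdec
  by_cases hK : Literature.Analysis.FluidPDE.HasGlobalKatoSolution ν u₀
  · exact Literature.Analysis.FluidPDE.clay_solution_of_hasGlobalKatoSolution_holds ν hν u₀ hsm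
      hdiv hdec hK
  · exact absurd (hAB (hX ν hν u₀ hsm hdiv hdec hK (hT.1 ν hν u₀ hsm hdiv hdec))) hT.2

end Summit.NavierStokesRegularity.NavierStokesRegularity.Theses.HardyPointSink
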